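import Summits.AtomisticToContinuum.FouriersLaw.Theorems.BondHeatUncertaintySubdiffusiveBondHeatKernelGibbsA
import Literature.MathematicalPhysics.KineticTheory.LangevinChainJointDensity
import Literature.Analysis.Hypoelliptic.HormanderProof
import Mathlib.Analysis.Calculus.ContDiff.Convolution
import Mathlib.Analysis.Calculus.BumpFunction.FiniteDimension

/-!
# Smooth transition densities and smooth forecasts for the pinned chain

Helper file for item stmt-AtomisticToContinuum-9144 (`ResponseDensity`, route
`OddSectorIrreversibility`, sub-problem `FouriersLaw` of `AtomisticToContinuum`), first step towards
the detailed balance of the equilibrium kernels (hypothesis `hDUAL` of the conditional reduction).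

* `pinnedChain_rbNondegenerate_V` — the coupling `V(r) = r²/2 + βr⁴/4` (`β ≥ 0`) is non-degenerate
  in the sense of Rey-Bellet–Thomas / CEHR Def. 2.4 (`V'' = 1 + 3βr² ≠ 0`);
* `pinnedChain_exists_transitionDensity` — CEHR Prop. 3.2 for the pinned chain: the transition
  kernels have a density `p ∈ C^∞((0,∞) × Ω × Ω)`, `p ≥ 0` (the tree's
  `langevin_jointDensity_of_hormander` with Hörmander's theorem `hormander1967_thm11_proof`, proved in
  the tree, and the identification `langevinKernel = transitionKernel`);
* `pinnedChain_contDiffOn_forecast` — hence for `F ∈ C_c(Ω)` the forecast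
  `(s, x) ↦ P_s F(x) = ∫ p(s, x, y) F(y) dy` is `C^∞` on `(0,∞) × Ω` (written as a convolution with a
  parameter, `contDiffOn_convolution_right_with_param_comp`).

No definitions.
-/

noncomputable section

open MeasureTheory ProbabilityTheory Filter Topology Set Metric Function
open scoped NNReal ENNReal ContDiff Convolution

namespace Summit.AtomisticToContinuum.FouriersLaw.Theorems

open Literature.MathematicalPhysics.KineticTheory.HeatConduction
open Literature.Probability.Process Literature.MathematicalPhysics.KineticTheory OscillatorChain
open Literature.Analysis.Distribution Literature.Analysis.Hypoelliptic

variable {N : ℕ}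

/-- The coupling of the pinned chain is RB-non-degenerate: `V''(r) = 1 + 3βr² ≠ 0` for `β ≥ 0`. -/
theorem pinnedChain_rbNondegenerate_V (ω₂ lam γ : ℝ) {β : ℝ} (hβ : 0 ≤ β) :
    RBNondegenerate (pinnedChain ω₂ lam β γ).V := by
  intro r
  refine ⟨2, le_rfl, ?_⟩
  have hV : (pinnedChain ω₂ lam β γ).V = fun r : ℝ => r ^ 2 / 2 + β * r ^ 4 / 4 := rfl
  have h1 : deriv (pinnedChain ω₂ lam β γ).V = fun r : ℝ => r + β * r ^ 3 := by
    funext r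
    rw [hV]
    have h : HasDerivAt (fun r : ℝ => r ^ 2 / 2 + β * r ^ 4 / 4) (r + β * r ^ 3) r := by
      have e1 : HasDerivAt (fun r : ℝ => r ^ 2) (2 * r) r := by simpa using hasDerivAt_pow 2 r
      have e2 : HasDerivAt (fun r : ℝ => r ^ 4) (4 * r ^ 3) r := by simpa using hasDerivAt_pow 4 r
      have h1 := (e1.div_const 2).add ((e2.const_mul β).div_const 4)
      exact h1.congr_deriv (by ring)
    exact h.deriv
  have h2 : deriv (fun r : ℝ => r + β * r ^ 3) r = 1 + 3 * β * r ^ 2 := by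
    have h : HasDerivAt (fun r : ℝ => r + β * r ^ 3) (1 + 3 * β * r ^ 2) r := by
      have e3 : HasDerivAt (fun r : ℝ => r ^ 3) (3 * r ^ 2) r := by simpa using hasDerivAt_pow 3 r
      have h1 := (hasDerivAt_id' r).add (e3.const_mul β)
      exact h1.congr_deriv (by ring)
    exact h.deriv
  rw [iteratedDeriv_succ, iteratedDeriv_one, h1, h2]
  have : 0 ≤ 3 * β * r ^ 2 := by positivity
  linarith

section Density

variable {ω₂ lam β γ : ℝ} (hω : 0 < ω₂) (hl : 0 ≤ lam) (hβ : 0 ≤ β) (hγ : 0 < γ) (hN : 0 < N)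
  {T_L T_R : ℝ} (hL : 0 < T_L) (hR : 0 ≤ T_R)
include hω hl hβ hγ hN hL hR

/-- **CEHR Prop. 3.2 for the pinned chain**: for `ω₂, γ, T_L > 0`, `lam, β, T_R ≥ 0`, `N ≥ 1`, the
transition kernels have a jointly smooth nonnegative density, `P_t(x, dy) = p(t, x, y) dy` for
`t > 0`, `p ∈ C^∞((0,∞) × Ω × Ω)`. -/
theorem pinnedChain_exists_transitionDensity :
    ∃ p : ℝ → PhaseSpace N → PhaseSpace N → ℝ,
      ContDiffOn ℝ ∞ (fun w : ℝ × PhaseSpace N × PhaseSpace N => p w.1 w.2.1 w.2.2)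
        (Set.Ioi (0 : ℝ) ×ˢ Set.univ) ∧
      (∀ t : ℝ, 0 < t → ∀ x y, 0 ≤ p t x y) ∧
      ∀ t : ℝ≥0, 0 < t → ∀ x : PhaseSpace N,
        (pinnedChain ω₂ lam β γ).transitionKernel N T_L T_R t x =
          (volume : Measure (PhaseSpace N)).withDensity fun y => ENNReal.ofReal (p t x y) := by
  obtain ⟨p, hp, hp0, hpk⟩ := OscillatorChain.IsConfining.langevin_jointDensity_of_hormander
    (SubdiffusiveBondHeat.pinnedChain_isConfining hω hl hβ hγ.le) (pinnedChain_contDiff_U ω₂ lam β γ)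
    (pinnedChain_contDiff_V ω₂ lam β γ) hN hL hR (T_L := T_L) (T_R := T_R) hormander1967_thm11_proof
    (pinnedChain_rbNondegenerate_V ω₂ lam γ hβ) hγ
  refine ⟨p, hp, hp0, fun t ht x => ?_⟩
  rw [← SubdiffusiveBondHeat.pinnedChain_langevinKernel_eq_transitionKernel N T_L T_R hω hl hβ hγ.le t]
  exact hpk t ht x

omit hω hl hβ hγ hN hL hR in
/-- The forecast of an observable through the density: `P_s F(x) = ∫ p(s, x, y) F(y) dy` (`s > 0`). -/
theorem pinnedChain_integral_kernel_eq_integral_density {p : ℝ → PhaseSpace N → PhaseSpace N → ℝ}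
    (hp : ContDiffOn ℝ ∞ (fun w : ℝ × PhaseSpace N × PhaseSpace N => p w.1 w.2.1 w.2.2)
      (Set.Ioi (0 : ℝ) ×ˢ Set.univ))
    (hp0 : ∀ t : ℝ, 0 < t → ∀ x y, 0 ≤ p t x y)
    (hpk : ∀ t : ℝ≥0, 0 < t → ∀ x : PhaseSpace N,
      (pinnedChain ω₂ lam β γ).transitionKernel N T_L T_R t x =
        (volume : Measure (PhaseSpace N)).withDensity fun y => ENNReal.ofReal (p t x y))
    (F : PhaseSpace N → ℝ) {s : ℝ} (hs : 0 < s) (x : PhaseSpace N) :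
    ∫ y, F y ∂((pinnedChain ω₂ lam β γ).transitionKernel N T_L T_R s.toNNReal x) =
      ∫ y, p s x y * F y := by
  have hs' : (0 : ℝ≥0) < s.toNNReal := Real.toNNReal_pos.2 hs
  rw [hpk _ hs' x, Real.coe_toNNReal _ hs.le]
  -- the density slice is continuous, hence measurable
  have hcont : Continuous fun y : PhaseSpace N => p s x y := by
    have h1 : ContinuousOn (fun w : ℝ × PhaseSpace N × PhaseSpace N => p w.1 w.2.1 w.2.2)
        (Set.Ioi (0 : ℝ) ×ˢ Set.univ) := hp.continuousOn
    have h2 : Continuous fun y : PhaseSpace N => ((s, (x, y)) : ℝ × PhaseSpace N × PhaseSpace N) := by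
      fun_prop
    exact h1.comp_continuous h2 fun y => ⟨hs, Set.mem_univ _⟩
  rw [integral_withDensity_eq_integral_toReal_smul₀ hcont.measurable.ennreal_ofReal.aemeasurable
    (Eventually.of_forall fun y => ENNReal.ofReal_lt_top)]
  refine integral_congr_ae (Eventually.of_forall fun y => ?_)
  simp only [ENNReal.toReal_ofReal (hp0 s hs x y), smul_eq_mul]

omit hω hl hβ hγ hN hL hR in
/-- **Smooth forecasts** (from a smooth density): for `F ∈ C_c(Ω)`,
`(s, x) ↦ P_s F(x)` is `C^∞` on `(0,∞) × Ω`. -/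
theorem contDiffOn_forecast_of_density {p : ℝ → PhaseSpace N → PhaseSpace N → ℝ}
    (hp : ContDiffOn ℝ ∞ (fun w : ℝ × PhaseSpace N × PhaseSpace N => p w.1 w.2.1 w.2.2)
      (Set.Ioi (0 : ℝ) ×ˢ Set.univ))
    {F : PhaseSpace N → ℝ} (hFc : Continuous F) (hFs : HasCompactSupport F) :
    ContDiffOn ℝ ∞ (fun w : ℝ × PhaseSpace N => ∫ y, p w.1 w.2 y * F y) (Set.Ioi (0 : ℝ) ×ˢ Set.univ) := by
  haveI := isAddHaarMeasure_volume_phaseSpace N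
  -- a smooth cutoff equal to one on the support of `F`
  obtain ⟨RF, hRF⟩ := hFs.isCompact.isBounded.subset_closedBall (0 : PhaseSpace N)
  set R₁ : ℝ := max RF 1 with hR₁
  have hR₁0 : 0 < R₁ := lt_max_of_lt_right one_pos
  let χ : ContDiffBump (0 : PhaseSpace N) := ⟨R₁, R₁ + 1, hR₁0, by linarith⟩
  have hχ1 : ∀ y ∈ tsupport F, (χ : PhaseSpace N → ℝ) y = 1 := by
    intro y hy
    apply χ.one_of_mem_closedBall
    have := hRF hy
    rw [mem_closedBall] at this ⊢
    exact this.trans (le_max_left _ _)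
  have hχF : ∀ y, (χ : PhaseSpace N → ℝ) y * F y = F y := by
    intro y
    by_cases hy : y ∈ tsupport F
    · rw [hχ1 y hy, one_mul]
    · rw [image_eq_zero_of_notMem_tsupport hy, mul_zero]
  -- it suffices to work on `(0,∞) × B(0, ρ)` for every `ρ`
  suffices hloc : ∀ ρ : ℝ, 0 < ρ → ContDiffOn ℝ ∞ (fun w : ℝ × PhaseSpace N => ∫ y, p w.1 w.2 y * F y)
      (Set.Ioi (0 : ℝ) ×ˢ ball (0 : PhaseSpace N) ρ) by
    intro w hw
    have hρ : 0 < ‖w.2‖ + 1 := by positivity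
    have hmem : w ∈ Set.Ioi (0 : ℝ) ×ˢ ball (0 : PhaseSpace N) (‖w.2‖ + 1) :=
      ⟨hw.1, by simp [mem_ball, dist_zero_right]⟩
    have h := (hloc _ hρ).contDiffWithinAt hmem
    refine (h.mono_of_mem_nhdsWithin ?_)
    exact mem_nhdsWithin_of_mem_nhds ((isOpen_Ioi.prod isOpen_ball).mem_nhds hmem)
  intro ρ hρ
  -- the parametrised kernel `g (s, x) w = p(s, x, x - w) χ(x - w)`
  set g : ℝ × PhaseSpace N → PhaseSpace N → ℝ :=
    fun q w => p q.1 q.2 (q.2 - w) * (χ : PhaseSpace N → ℝ) (q.2 - w) with hg_def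
  set sP : Set (ℝ × PhaseSpace N) := Set.Ioi (0 : ℝ) ×ˢ ball (0 : PhaseSpace N) ρ with hsP
  have hsO : IsOpen sP := isOpen_Ioi.prod isOpen_ball
  set k : Set (PhaseSpace N) := closedBall (0 : PhaseSpace N) (ρ + (R₁ + 1)) with hk
  have hkc : IsCompact k := isCompact_closedBall _ _
  have hgs : ∀ q w, q ∈ sP → w ∉ k → g q w = 0 := by
    intro q w hq hw
    simp only [hsP, Set.mem_prod, Set.mem_Ioi, mem_ball, dist_zero_right] at hq
    simp only [hk, mem_closedBall, dist_zero_right, not_le] at hw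
    have hfar : (χ : PhaseSpace N → ℝ) (q.2 - w) = 0 := by
      apply χ.zero_of_le_dist
      rw [dist_zero_right]
      have : ‖w‖ ≤ ‖q.2 - w‖ + ‖q.2‖ := by
        calc ‖w‖ = ‖q.2 - (q.2 - w)‖ := by rw [sub_sub_cancel]
          _ ≤ ‖q.2‖ + ‖q.2 - w‖ := norm_sub_le _ _
          _ = _ := add_comm _ _
      change R₁ + 1 ≤ ‖q.2 - w‖
      linarith
    simp only [hg_def, hfar, mul_zero]
  have hgd : ContDiffOn ℝ ∞ ↿g (sP ×ˢ Set.univ) := by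
    have e : ↿g = fun z : (ℝ × PhaseSpace N) × PhaseSpace N =>
        (fun w : ℝ × PhaseSpace N × PhaseSpace N => p w.1 w.2.1 w.2.2) (z.1.1, (z.1.2, z.1.2 - z.2)) *
          (χ : PhaseSpace N → ℝ) (z.1.2 - z.2) := by
      funext z; rfl
    rw [e]
    refine ContDiffOn.mul ?_ ?_
    · refine hp.comp (by fun_prop) ?_
      intro z hz
      simp only [hsP, Set.mem_prod, Set.mem_univ, and_true, Set.mem_Ioi] at hz ⊢
      exact hz.1
    · exact (χ.contDiff.comp (by fun_prop)).contDiffOn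
  have hconv := contDiffOn_convolution_right_with_param_comp (𝕜 := ℝ) (μ := (volume : Measure (PhaseSpace N)))
    (n := (⊤ : ℕ∞)) (ContinuousLinearMap.lsmul ℝ ℝ) (s := sP) (v := fun q : ℝ × PhaseSpace N => q.2)
    contDiffOn_snd (f := F) (g := g) (k := k) hsO hkc hgs (hFc.locallyIntegrable) hgd
  -- identify the convolution with the forecast
  refine hconv.congr fun q hq => ?_
  rw [convolution_def]
  refine integral_congr_ae (Eventually.of_forall fun y => ?_)
  simp only [hg_def, ContinuousLinearMap.lsmul_apply, smul_eq_mul, sub_sub_cancel]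
  rw [mul_comm (p q.1 q.2 y)]
  conv_lhs => rw [← hχF y]
  ring

/-- **Smooth forecasts for the pinned chain**: for `F ∈ C_c(Ω)`, `(s, x) ↦ P_s F(x)` is `C^∞` on
`(0,∞) × Ω` (`ω₂, γ, T_L > 0`, `lam, β, T_R ≥ 0`, `N ≥ 1`). -/
theorem pinnedChain_contDiffOn_forecast {F : PhaseSpace N → ℝ} (hFc : Continuous F)
    (hFs : HasCompactSupport F) :
    ContDiffOn ℝ ∞ (fun w : ℝ × PhaseSpace N =>
      ∫ y, F y ∂((pinnedChain ω₂ lam β γ).transitionKernel N T_L T_R w.1.toNNReal w.2))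
      (Set.Ioi (0 : ℝ) ×ˢ Set.univ) := by
  obtain ⟨p, hp, hp0, hpk⟩ := pinnedChain_exists_transitionDensity hω hl hβ hγ hN hL hR
  refine (contDiffOn_forecast_of_density hp hFc hFs).congr fun w hw => ?_
  exact pinnedChain_integral_kernel_eq_integral_density hp hp0 hpk F hw.1 w.2

end Density

end Summit.AtomisticToContinuum.FouriersLaw.Theorems

end
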